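import Summits.QuantumFields.BalabanUV.Beta.GAN24.EffectiveFormLocalisation
import Summits.QuantumFields.BalabanUV.Beta.GAN24.EffectiveFormLocalisationLatticeLetters

/-!
# `BalabanUV.Beta.GAN24.EffectiveFormLocalisationLatticeSoft` — binder row G-an2-4 ∕ (CONV-C), route R6 «VALUES, NOT DERIVATIVES», PART 109:
# S2′(h) ON THE ONE-STEP BLOCK LATTICE, I: THE SOFT LETTER — for every torus, every orthogonal background `R, W` and every symmetric, squeezed, block-local fine form,
# the regularised resolvent `K⁻¹ = (H_f + Qᵀ(a•1)Q)⁻¹` decays exponentially in the TORUS BLOCK DISTANCE (finite Combes–Thomas with PART 108's coercivity), and PART 105 §4's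
# two unit-lattice letters follow, with constants that are CLOSED EXPRESSIONS in `(d, L, |o|, a, w_f, w_f′, h₀, δ_H)` — neither the torus `(ℤ∕M)^d` nor `R, W` enter
# (unit b2b-balaban-gan24-p3, gen 50; v1)

NOT IN PRINT; OUR PROOF (for the ROUTE; [folklore] composition BY NAME: PART 105 (`abs_effForm_le`, `abs_minOp_le`, `abs_blockProp_le_of_resolvent`,
`abs_inv_mul_transpose_le_of_resolvent`), PART 108 (`ub_lattice`, `coercive_reg_lattice`, `sum_abs_Q_row_le`, `Q_apply_eq_zero`, `abs_reg_apply_le`, `reg_apply_eq_zero`),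
the torus distance and lattice sums of `B4Sect5Torus` (`tdist`, `torusSum_le`) and its finite Combes–Thomas `inv_decay` via `FP.WellConditionedInverseLocality`).
HONEST FRAMING (cell contract, verbatim): «discharging `BetaPertH` makes Bałaban's UV stability UNCONDITIONAL — a real constructive-QFT result; it is NOT the continuum limit and NOT
the Clay problem.»  HONEST DEPENDENCY (verbatim): «continuum YM on T⁴ ⇐ BetaPertH ∧ nine spine estimates (0/9 proved); BetaPertH ⇐ (D1) ∧ (D4) ∧ CAP+tail; G-an2-4 gates asym, D1
and NE2/3/4.»

THE SETTING (PART 108's lattice): unit sites `Fin d → ZMod M` read as points of the discrete torus `Fin d → Fin M` through `ZMod.finEquiv`, torus sup-distance `tdist`; the unit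
pseudo-distance `ρ(b,b′) = tdist(b.1, b′.1)`, the fine one `D(p,q) = tdist(p.1.1, q.1.1)` (block labels), the fine-to-unit gauge `σ(p,b) = tdist(p.1.1, b.1)`; the fine form `H_f` is
SYMMETRIC, squeezed (`w_f·Σ_e|R_eu(e⁺) − u(e⁻)|² ≤ ⟨u,H_fu⟩ ≤ w_f′·Σ_e|…|²`, `0 < w_f`) and BLOCK-LOCAL in the displayed sense `|H_f(p,q)| ≤ h₀·e^{−δ_H·D(p,q)}` (`δ_H > 0`; the
covariant Laplacian `w·Δ_R` has range one block, so any `δ_H` with `h₀ = w(2d+…)e^{δ_H}` serves).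
WHAT THIS FILE PROVES (0 sorry, 0 `def`, nothing cited):
* §1 torus bookkeeping: `one_le_const`, `isPseudoDist_unit`, `sum_exp_blocks_le` (`Σ_y e^{−s·tdist} ≤ K_d(s)`), `sum_exp_unit_le` (profile `|o|·K_d(s)`), `sum_exp_fine_le'`
  (profile `|o|·L^d·K_d(s)`), `tdist_fine_le_unit` (`D ≤ σ + σ`).
* §2 `abs_K_apply_le` — `|K(p,q)| ≤ (h₀ + a|o|(L^d)⁻²)·e^{−δ_H D(p,q)}` for `K = H_f + Qᵀ(a•1)Q`; `coercive_K` — PART 108's coercivity in `QGQInverse.Coercive` form;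
  **`abs_Kinv_apply_le`** — THE SOFT LETTER ON THE BLOCK LATTICE: `|K⁻¹(p,q)| ≤ (2∕γ_K)·e^{−r_F·D(p,q)}`, `r_F = rate (s ↦ |o|L^dK_d(s)) γ_K (h₀ + a|o|(L^d)⁻²) δ_H` (finite
  Combes–Thomas, every orthogonal `R`, `W`, every torus).
* §3 `gammaK_pos`, `fst_eq_of_Q_ne_zero`, **`abs_blockProp_le_lattice`** (`|P(b,b′)| ≤ |o|²(2∕γ_K)e^{−r_F·tdist(b.1,b′.1)}`), **`abs_Kinv_mul_transpose_le_lattice`**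
  (`|(K⁻¹Qᵀ)(p,b)| ≤ |o|(2∕γ_K)e^{−r_F·tdist(p.1.1,b.1)}`) — PART 105 §4's two unit letters with `q₁ = |o|`, `R = R′ = 0`; the abbreviations `γ_K, c_K, r_F` enter as displayed
  EQUATIONS (instantiate with `rfl`).  The ENDs for `𝒮` and `ℋ` are the companion file `EffectiveFormLocalisationLatticeEnd` (PART 110).
HONEST: ONE block step; at one step every letter is background-free, so this is NOT a k-uniform statement along Bałaban's tower and NOT his `Δ_a(U)`; it shows PARTs 105 ∕ 108's
hypotheses are jointly satisfiable on the lineage's own lattice (non-vacuity) and gives the one-step decay of `𝒮`, `ℋ` for every orthogonal background; SUPPLIER work on route C-R6°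
(rank 2, REDUCTION); no consumer of record; NEVER «G-an2-4 closed»; NOT (CONV-C), NOT D1, NOT `BetaPertH`, NOT continuum, NOT Clay.  Records: `HOME/b2b-balaban-gan24-p3/gen50/README.md`.
-/

noncomputable section

open scoped BigOperators Matrix
open Matrix Finset Function
open Literature.MathematicalPhysics.QuantumFieldTheory.Balaban1983to89
open Literature.MathematicalPhysics.QuantumFieldTheory.Balaban1983to89.B4Sect5Torus (IsPseudoDist SumBound rate rate_pos tdist tdist_symm tdist_self
  tdist_triangle tdist_nonneg torusSum_le)
open Literature.MathematicalPhysics.QuantumFieldTheory.Balaban1983to89.B4Sect5Proof (latticeConst latticeConst_nonneg)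
open Literature.MathematicalPhysics.QuantumFieldTheory.Balaban1983to89.Beta.Composition (kkt blockProp)
open Literature.MathematicalPhysics.QuantumFieldTheory.Balaban1983to89.Beta.CompositionSingular (effForm minOp)
open Summit.QuantumFields.BalabanUV.Beta.FP.WellConditionedInverseLocality (abs_inv_le_of_coercive_localised)
open Summit.QuantumFields.BalabanUV.Beta.GAN24.EffectiveFormLocalisation (transpose_reg form_reg abs_effForm_le abs_minOp_le abs_blockProp_le_of_resolvent
  abs_inv_mul_transpose_le_of_resolvent)
open Summit.QuantumFields.BalabanUV.Beta.GAN24.EffectiveFormLocalisationLatticeLetters (ub_lattice coercive_reg_lattice sum_abs_Q_row_le Q_apply_eq_zero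
  abs_reg_apply_le reg_apply_eq_zero)
open Summit.QuantumFields.BalabanUV.Beta.GAN24.DerivativeRateTransferJensenChain (dotProduct_self_nonneg')

namespace Summit.QuantumFields.BalabanUV.Beta.GAN24.EffectiveFormLocalisationLatticeSoft

variable {d L M : ℕ} {o : Type*} [Fintype o] [DecidableEq o]
variable [NeZero M] [NeZero L]

/-! ## §1 Torus bookkeeping: the unit sites as torus points, distances, lattice sums -/

omit [NeZero L] in
/-- the constant period vector `(M, …, M)` has entries `≥ 1`. [folklore] -/
theorem one_le_const : ∀ _i : Fin d, 1 ≤ (fun _ : Fin d => M) _i := fun _ => Nat.one_le_iff_ne_zero.mpr (NeZero.ne M)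

omit [NeZero L] [DecidableEq o] [Fintype o] in
/-- the torus block distance on the unit index set is a pseudo-distance. [folklore] -/
theorem isPseudoDist_unit :
    IsPseudoDist (fun b b' : (Fin d → ZMod M) × o =>
      tdist (fun _ : Fin d => M) (fun i => (ZMod.finEquiv M).symm (b.1 i)) (fun i => (ZMod.finEquiv M).symm (b'.1 i))) :=
  ⟨fun _ _ => tdist_symm one_le_const _ _, fun _ => tdist_self _ _, fun _ _ _ => tdist_triangle one_le_const _ _ _⟩

omit [NeZero L] in
/-- **block-label lattice sums**: `Σ_y e^{−s·tdist(y₀,y)} ≤ K_d(s)` over `y : Fin d → ZMod M` (`B4Sect5Torus.torusSum_le` through `ZMod.finEquiv`, uniformly in `M`).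
[folklore] -/
theorem sum_exp_blocks_le {s : ℝ} (hs : 0 < s) (y₀ : Fin d → ZMod M) :
    ∑ y : Fin d → ZMod M,
        Real.exp (-(s * tdist (fun _ : Fin d => M) (fun i => (ZMod.finEquiv M).symm (y₀ i)) (fun i => (ZMod.finEquiv M).symm (y i)))) ≤
      latticeConst d s := by
  have h := torusSum_le d (P := fun _ : Fin d => M) one_le_const hs (fun i => (ZMod.finEquiv M).symm (y₀ i))
  refine le_trans (le_of_eq ?_) h
  exact Equiv.sum_comp (Equiv.piCongrRight fun _ : Fin d => (ZMod.finEquiv M).toEquiv.symm)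
    (fun z : (Fin d → Fin M) => Real.exp (-(s * tdist (fun _ : Fin d => M) (fun i => (ZMod.finEquiv M).symm (y₀ i)) z)))

omit [NeZero L] [DecidableEq o] in
/-- **unit lattice sums**: `Σ_{(y,a)} e^{−s·tdist(y₀,y)} ≤ |o|·K_d(s)`. [folklore] -/
theorem sum_exp_unit_le {s : ℝ} (hs : 0 < s) (y₀ : Fin d → ZMod M) :
    ∑ b : (Fin d → ZMod M) × o,
        Real.exp (-(s * tdist (fun _ : Fin d => M) (fun i => (ZMod.finEquiv M).symm (y₀ i)) (fun i => (ZMod.finEquiv M).symm (b.1 i)))) ≤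
      Fintype.card o * latticeConst d s := by
  rw [Fintype.sum_prod_type]
  simp only [Finset.sum_const, Finset.card_univ, nsmul_eq_mul]
  rw [← Finset.mul_sum]
  exact mul_le_mul_of_nonneg_left (sum_exp_blocks_le hs y₀) (Nat.cast_nonneg _)

omit [NeZero L] [DecidableEq o] in
/-- **fine lattice sums against the block distance**: `Σ_{((x),b)} e^{−s·tdist(y₀,x.1)} ≤ |o|·L^d·K_d(s)`. [folklore] -/
theorem sum_exp_fine_le' {s : ℝ} (hs : 0 < s) (y₀ : Fin d → ZMod M) :
    ∑ q : ((Fin d → ZMod M) × (Fin d → Fin L)) × o,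
        Real.exp (-(s * tdist (fun _ : Fin d => M) (fun i => (ZMod.finEquiv M).symm (y₀ i)) (fun i => (ZMod.finEquiv M).symm (q.1.1 i)))) ≤
      Fintype.card o * (L : ℝ) ^ d * latticeConst d s := by
  rw [Fintype.sum_prod_type]
  simp only [Finset.sum_const, Finset.card_univ, nsmul_eq_mul]
  rw [← Finset.mul_sum, Fintype.sum_prod_type]
  simp only [Finset.sum_const, Finset.card_univ, Fintype.card_fun, Fintype.card_fin, nsmul_eq_mul]
  rw [← Finset.mul_sum, mul_assoc]
  refine mul_le_mul_of_nonneg_left ?_ (Nat.cast_nonneg _)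
  push_cast
  exact mul_le_mul_of_nonneg_left (sum_exp_blocks_le hs y₀) (by positivity)

omit [NeZero L] in
/-- `D(p,q) ≤ σ(p,b) + σ(q,b)` (triangle inequality through the unit site `b`). [folklore] -/
theorem tdist_fine_le_unit (x x' y : Fin d → ZMod M) :
    tdist (fun _ : Fin d => M) (fun i => (ZMod.finEquiv M).symm (x i)) (fun i => (ZMod.finEquiv M).symm (x' i)) ≤
      tdist (fun _ : Fin d => M) (fun i => (ZMod.finEquiv M).symm (x i)) (fun i => (ZMod.finEquiv M).symm (y i)) +
        tdist (fun _ : Fin d => M) (fun i => (ZMod.finEquiv M).symm (x' i)) (fun i => (ZMod.finEquiv M).symm (y i)) := by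
  have h := tdist_triangle one_le_const (fun i => (ZMod.finEquiv M).symm (x i)) (fun i => (ZMod.finEquiv M).symm (y i))
    (fun i => (ZMod.finEquiv M).symm (x' i))
  rw [tdist_symm one_le_const (fun i => (ZMod.finEquiv M).symm (y i))] at h
  exact h

/-! ## §2 The regularised form on the block lattice: entries, coercivity, and the soft letter -/

section Soft

variable {W : (Fin d → ZMod M) → (Fin d → ZMod M) × (Fin d → Fin L) → Matrix o o ℝ}
variable {Q : Matrix ((Fin d → ZMod M) × o) (((Fin d → ZMod M) × (Fin d → Fin L)) × o) ℝ}
variable {Hf : Matrix (((Fin d → ZMod M) × (Fin d → Fin L)) × o) (((Fin d → ZMod M) × (Fin d → Fin L)) × o) ℝ}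

omit [NeZero L] in
/-- **`abs_K_apply_le` — THE ENTRIES OF `K = H_f + Qᵀ(a•1)Q`**: a block-local fine form `|H_f(p,q)| ≤ h₀e^{−δ_H D(p,q)}` and the block-diagonal regularisation (PART 108 §3)
give `|K(p,q)| ≤ (h₀ + a·|o|·(L^d)⁻²)·e^{−δ_H·D(p,q)}`. [our proof] -/
theorem abs_K_apply_le (hW : ∀ y x, (W y x)ᵀ * W y x = 1)
    (hQ : ∀ (u : ((Fin d → ZMod M) × (Fin d → Fin L)) × o → ℝ) (y : Fin d → ZMod M),
      (fun a => (Q *ᵥ u) (y, a)) = ∑ x, (if x.1 = y then ((L : ℝ) ^ d)⁻¹ else 0) • (W y x *ᵥ fun b => u (x, b)))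
    {a h₀ δH : ℝ} (ha : 0 ≤ a)
    (hHent : ∀ p q : ((Fin d → ZMod M) × (Fin d → Fin L)) × o, |Hf p q| ≤
      h₀ * Real.exp (-(δH * tdist (fun _ : Fin d => M) (fun i => (ZMod.finEquiv M).symm (p.1.1 i)) (fun i => (ZMod.finEquiv M).symm (q.1.1 i)))))
    (p q : ((Fin d → ZMod M) × (Fin d → Fin L)) × o) :
    |(Hf + Qᵀ * (a • (1 : Matrix ((Fin d → ZMod M) × o) ((Fin d → ZMod M) × o) ℝ)) * Q) p q| ≤
      (h₀ + a * Fintype.card o * (((L : ℝ) ^ d)⁻¹) ^ 2) *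
        Real.exp (-(δH * tdist (fun _ : Fin d => M) (fun i => (ZMod.finEquiv M).symm (p.1.1 i)) (fun i => (ZMod.finEquiv M).symm (q.1.1 i)))) := by
  rw [Matrix.add_apply, add_mul]
  refine (abs_add_le _ _).trans (add_le_add (hHent p q) ?_)
  by_cases hpq : p.1.1 = q.1.1
  · rw [hpq, tdist_self, mul_zero, neg_zero, Real.exp_zero, mul_one]
    exact abs_reg_apply_le hW hQ ha p q
  · rw [reg_apply_eq_zero hQ a hpq, abs_zero]
    positivity

/-- **`coercive_K`** — PART 108's full coercivity in `QGQInverse.Coercive` form: `γ_K·|u|² ≤ ⟨u, Ku⟩`. [our proof] -/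
theorem coercive_K (hL : 0 < L) {R : ((Fin d → ZMod M) × (Fin d → Fin L)) × Fin d → Matrix o o ℝ} (hR : ∀ e, (R e)ᵀ * R e = 1)
    (hW : ∀ y x, (W y x)ᵀ * W y x = 1)
    (hWstep : ∀ (y : Fin d → ZMod M) (z : Fin d → Fin L) (μ : Fin d) (h : (z μ : ℕ) + 1 < L), (∀ ν, μ < ν → (z ν : ℕ) = 0) →
      W y (y, update z μ ⟨(z μ : ℕ) + 1, h⟩) = W y (y, z) * R ((y, z), μ))
    (hQ : ∀ (u : ((Fin d → ZMod M) × (Fin d → Fin L)) × o → ℝ) (y : Fin d → ZMod M),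
      (fun a => (Q *ᵥ u) (y, a)) = ∑ x, (if x.1 = y then ((L : ℝ) ^ d)⁻¹ else 0) • (W y x *ᵥ fun b => u (x, b)))
    (hHsym : Hfᵀ = Hf) {wf wf' : ℝ} (hwf : 0 < wf) (hwf' : 0 ≤ wf')
    (hHf : ∀ u : ((Fin d → ZMod M) × (Fin d → Fin L)) × o → ℝ,
      wf * ∑ e : ((Fin d → ZMod M) × (Fin d → Fin L)) × Fin d,
        ((R e *ᵥ fun b => u ((e.1.1 + ((((e.1.2 e.2 : ℕ) + 1) / L) • (Pi.single e.2 (1 : ZMod M))),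
            update e.1.2 e.2 ⟨((e.1.2 e.2 : ℕ) + 1) % L, Nat.mod_lt _ hL⟩), b)) - fun b => u (e.1, b)) ⬝ᵥ
          ((R e *ᵥ fun b => u ((e.1.1 + ((((e.1.2 e.2 : ℕ) + 1) / L) • (Pi.single e.2 (1 : ZMod M))),
            update e.1.2 e.2 ⟨((e.1.2 e.2 : ℕ) + 1) % L, Nat.mod_lt _ hL⟩), b)) - fun b => u (e.1, b)) ≤ u ⬝ᵥ (Hf *ᵥ u))
    (hHf' : ∀ u : ((Fin d → ZMod M) × (Fin d → Fin L)) × o → ℝ, u ⬝ᵥ (Hf *ᵥ u) ≤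
      wf' * ∑ e : ((Fin d → ZMod M) × (Fin d → Fin L)) × Fin d,
        ((R e *ᵥ fun b => u ((e.1.1 + ((((e.1.2 e.2 : ℕ) + 1) / L) • (Pi.single e.2 (1 : ZMod M))),
            update e.1.2 e.2 ⟨((e.1.2 e.2 : ℕ) + 1) % L, Nat.mod_lt _ hL⟩), b)) - fun b => u (e.1, b)) ⬝ᵥ
          ((R e *ᵥ fun b => u ((e.1.1 + ((((e.1.2 e.2 : ℕ) + 1) / L) • (Pi.single e.2 (1 : ZMod M))),
            update e.1.2 e.2 ⟨((e.1.2 e.2 : ℕ) + 1) % L, Nat.mod_lt _ hL⟩), b)) - fun b => u (e.1, b)))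
    {a : ℝ} (ha : 0 < a) :
    QGQInverse.Coercive (Hf + Qᵀ * (a • (1 : Matrix ((Fin d → ZMod M) × o) ((Fin d → ZMod M) × o) ℝ)) * Q)
      (max (4 * (4 * (d * ((L : ℝ) - 1)) ^ 2 * (L : ℝ) ^ d / wf))
        ((16 * d * (4 * (d * ((L : ℝ) - 1)) ^ 2 * (L : ℝ) ^ d / wf) * wf' * (L : ℝ) ^ d + 2 * (L : ℝ) ^ d) / a))⁻¹ := fun u => by
  rw [form_reg]
  exact coercive_reg_lattice hL hR hW hWstep hQ hHsym hwf hwf' hHf hHf' ha u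

/-- **`abs_Kinv_apply_le` — THE SOFT LETTER ON THE ONE-STEP BLOCK LATTICE** [our proof; finite Combes–Thomas `abs_inv_le_of_coercive_localised` with PART 108's coercivity and
`abs_K_apply_le`]: for every torus, every orthogonal `R`, `W` (comb letter) and every symmetric, squeezed, block-local fine form:
`|K⁻¹(p,q)| ≤ (2∕γ_K)·e^{−r_F·D(p,q)}`, `r_F = rate (s ↦ |o|·L^d·K_d(s)) γ_K (h₀ + a|o|(L^d)⁻²) δ_H`. -/
theorem abs_Kinv_apply_le (hL : 0 < L) {R : ((Fin d → ZMod M) × (Fin d → Fin L)) × Fin d → Matrix o o ℝ} (hR : ∀ e, (R e)ᵀ * R e = 1)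
    (hW : ∀ y x, (W y x)ᵀ * W y x = 1)
    (hWstep : ∀ (y : Fin d → ZMod M) (z : Fin d → Fin L) (μ : Fin d) (h : (z μ : ℕ) + 1 < L), (∀ ν, μ < ν → (z ν : ℕ) = 0) →
      W y (y, update z μ ⟨(z μ : ℕ) + 1, h⟩) = W y (y, z) * R ((y, z), μ))
    (hQ : ∀ (u : ((Fin d → ZMod M) × (Fin d → Fin L)) × o → ℝ) (y : Fin d → ZMod M),
      (fun a => (Q *ᵥ u) (y, a)) = ∑ x, (if x.1 = y then ((L : ℝ) ^ d)⁻¹ else 0) • (W y x *ᵥ fun b => u (x, b)))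
    (hHsym : Hfᵀ = Hf) {wf wf' : ℝ} (hwf : 0 < wf) (hwf' : 0 ≤ wf')
    (hHf : ∀ u : ((Fin d → ZMod M) × (Fin d → Fin L)) × o → ℝ,
      wf * ∑ e : ((Fin d → ZMod M) × (Fin d → Fin L)) × Fin d,
        ((R e *ᵥ fun b => u ((e.1.1 + ((((e.1.2 e.2 : ℕ) + 1) / L) • (Pi.single e.2 (1 : ZMod M))),
            update e.1.2 e.2 ⟨((e.1.2 e.2 : ℕ) + 1) % L, Nat.mod_lt _ hL⟩), b)) - fun b => u (e.1, b)) ⬝ᵥ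
          ((R e *ᵥ fun b => u ((e.1.1 + ((((e.1.2 e.2 : ℕ) + 1) / L) • (Pi.single e.2 (1 : ZMod M))),
            update e.1.2 e.2 ⟨((e.1.2 e.2 : ℕ) + 1) % L, Nat.mod_lt _ hL⟩), b)) - fun b => u (e.1, b)) ≤ u ⬝ᵥ (Hf *ᵥ u))
    (hHf' : ∀ u : ((Fin d → ZMod M) × (Fin d → Fin L)) × o → ℝ, u ⬝ᵥ (Hf *ᵥ u) ≤
      wf' * ∑ e : ((Fin d → ZMod M) × (Fin d → Fin L)) × Fin d,
        ((R e *ᵥ fun b => u ((e.1.1 + ((((e.1.2 e.2 : ℕ) + 1) / L) • (Pi.single e.2 (1 : ZMod M))),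
            update e.1.2 e.2 ⟨((e.1.2 e.2 : ℕ) + 1) % L, Nat.mod_lt _ hL⟩), b)) - fun b => u (e.1, b)) ⬝ᵥ
          ((R e *ᵥ fun b => u ((e.1.1 + ((((e.1.2 e.2 : ℕ) + 1) / L) • (Pi.single e.2 (1 : ZMod M))),
            update e.1.2 e.2 ⟨((e.1.2 e.2 : ℕ) + 1) % L, Nat.mod_lt _ hL⟩), b)) - fun b => u (e.1, b)))
    {a h₀ δH : ℝ} (ha : 0 < a) (hh₀ : 0 ≤ h₀) (hδH : 0 < δH)
    (hHent : ∀ p q : ((Fin d → ZMod M) × (Fin d → Fin L)) × o, |Hf p q| ≤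
      h₀ * Real.exp (-(δH * tdist (fun _ : Fin d => M) (fun i => (ZMod.finEquiv M).symm (p.1.1 i)) (fun i => (ZMod.finEquiv M).symm (q.1.1 i)))))
    (p q : ((Fin d → ZMod M) × (Fin d → Fin L)) × o) :
    |(Hf + Qᵀ * (a • (1 : Matrix ((Fin d → ZMod M) × o) ((Fin d → ZMod M) × o) ℝ)) * Q)⁻¹ p q| ≤
      2 / (max (4 * (4 * (d * ((L : ℝ) - 1)) ^ 2 * (L : ℝ) ^ d / wf))
          ((16 * d * (4 * (d * ((L : ℝ) - 1)) ^ 2 * (L : ℝ) ^ d / wf) * wf' * (L : ℝ) ^ d + 2 * (L : ℝ) ^ d) / a))⁻¹ *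
        Real.exp (-(rate (fun s => Fintype.card o * (L : ℝ) ^ d * latticeConst d s)
          (max (4 * (4 * (d * ((L : ℝ) - 1)) ^ 2 * (L : ℝ) ^ d / wf))
            ((16 * d * (4 * (d * ((L : ℝ) - 1)) ^ 2 * (L : ℝ) ^ d / wf) * wf' * (L : ℝ) ^ d + 2 * (L : ℝ) ^ d) / a))⁻¹
          (h₀ + a * Fintype.card o * (((L : ℝ) ^ d)⁻¹) ^ 2) δH *
            tdist (fun _ : Fin d => M) (fun i => (ZMod.finEquiv M).symm (p.1.1 i)) (fun i => (ZMod.finEquiv M).symm (q.1.1 i)))) := by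
  have hco := coercive_K hL hR hW hWstep hQ hHsym hwf hwf' hHf hHf' ha
  set C : ℝ := max (4 * (4 * (d * ((L : ℝ) - 1)) ^ 2 * (L : ℝ) ^ d / wf))
    ((16 * d * (4 * (d * ((L : ℝ) - 1)) ^ 2 * (L : ℝ) ^ d / wf) * wf' * (L : ℝ) ^ d + 2 * (L : ℝ) ^ d) / a) with hC
  have hLd : 0 < (L : ℝ) ^ d := pow_pos (Nat.cast_pos.mpr hL) d
  have hCpos : 0 < C := lt_of_lt_of_le (by positivity : 0 < (16 * d * (4 * (d * ((L : ℝ) - 1)) ^ 2 * (L : ℝ) ^ d / wf) * wf' * (L : ℝ) ^ d +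
    2 * (L : ℝ) ^ d) / a) (le_max_right _ _)
  have hprof : ∀ s : ℝ, 0 < s → 0 ≤ Fintype.card o * (L : ℝ) ^ d * latticeConst d s := fun s hs => by
    have := latticeConst_nonneg d hs.le; positivity
  have hρ : IsPseudoDist (fun p q : ((Fin d → ZMod M) × (Fin d → Fin L)) × o =>
      tdist (fun _ : Fin d => M) (fun i => (ZMod.finEquiv M).symm (p.1.1 i)) (fun i => (ZMod.finEquiv M).symm (q.1.1 i))) :=
    ⟨fun _ _ => tdist_symm one_le_const _ _, fun _ => tdist_self _ _, fun _ _ _ => tdist_triangle one_le_const _ _ _⟩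
  have hS : SumBound (fun p q : ((Fin d → ZMod M) × (Fin d → Fin L)) × o =>
      tdist (fun _ : Fin d => M) (fun i => (ZMod.finEquiv M).symm (p.1.1 i)) (fun i => (ZMod.finEquiv M).symm (q.1.1 i)))
      (fun s => Fintype.card o * (L : ℝ) ^ d * latticeConst d s) := fun s hs p => sum_exp_fine_le' hs p.1.1
  have hc₀ : 0 ≤ h₀ + a * Fintype.card o * (((L : ℝ) ^ d)⁻¹) ^ 2 := by positivity
  exact abs_inv_le_of_coercive_localised hprof hρ hS (transpose_reg hHsym a) (inv_pos.mpr hCpos) hc₀ hδH hco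
    (abs_K_apply_le hW hQ ha.le hHent) p q

end Soft


/-! ## §3 The two unit-lattice letters of PART 105 §4 on the block lattice -/

section Letters

variable {W : (Fin d → ZMod M) → (Fin d → ZMod M) × (Fin d → Fin L) → Matrix o o ℝ}
variable {Q : Matrix ((Fin d → ZMod M) × o) (((Fin d → ZMod M) × (Fin d → Fin L)) × o) ℝ}
variable {Hf : Matrix (((Fin d → ZMod M) × (Fin d → Fin L)) × o) (((Fin d → ZMod M) × (Fin d → Fin L)) × o) ℝ}

omit [NeZero L] in
/-- positivity of PART 108's coercivity constant. [folklore] -/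
theorem gammaK_pos (hL : 0 < L) {wf wf' a : ℝ} (hwf : 0 < wf) (hwf' : 0 ≤ wf') (ha : 0 < a) :
    0 < (max (4 * (4 * (d * ((L : ℝ) - 1)) ^ 2 * (L : ℝ) ^ d / wf))
        ((16 * d * (4 * (d * ((L : ℝ) - 1)) ^ 2 * (L : ℝ) ^ d / wf) * wf' * (L : ℝ) ^ d + 2 * (L : ℝ) ^ d) / a))⁻¹ := by
  have hLd : 0 < (L : ℝ) ^ d := pow_pos (Nat.cast_pos.mpr hL) d
  exact inv_pos.mpr (lt_of_lt_of_le (by positivity) (le_max_right _ _))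

omit [NeZero L] in
/-- the support of the averaging: `Q b p ≠ 0 ⟹ p.1.1 = b.1` (contrapositive of PART 108's `Q_apply_eq_zero`). [folklore] -/
theorem fst_eq_of_Q_ne_zero
    (hQ : ∀ (u : ((Fin d → ZMod M) × (Fin d → Fin L)) × o → ℝ) (y : Fin d → ZMod M),
      (fun a => (Q *ᵥ u) (y, a)) = ∑ x, (if x.1 = y then ((L : ℝ) ^ d)⁻¹ else 0) • (W y x *ᵥ fun b => u (x, b)))
    {b : (Fin d → ZMod M) × o} {p : ((Fin d → ZMod M) × (Fin d → Fin L)) × o} (h : Q b p ≠ 0) : p.1.1 = b.1 := by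
  by_contra hne
  exact h (Q_apply_eq_zero hQ (y := b.1) (x := p.1) hne b.2 p.2)

/-- **`abs_blockProp_le_lattice` — THE UNIT-LATTICE DECAY OF `P = QK⁻¹Qᵀ` ON THE BLOCK LATTICE** [our proof; PART 105 `abs_blockProp_le_of_resolvent` with the soft letter
`abs_Kinv_apply_le`, row mass `|o|` (PART 108 `sum_abs_Q_row_le`) and exact block compatibility `R = 0`]: with the abbreviations `γ_K`, `c_K`, `r_F` (displayed as equations),
`|P(b,b′)| ≤ |o|²·(2∕γ_K)·e^{−r_F·tdist(b.1,b′.1)}`. -/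
theorem abs_blockProp_le_lattice (hL : 0 < L) {R : ((Fin d → ZMod M) × (Fin d → Fin L)) × Fin d → Matrix o o ℝ} (hR : ∀ e, (R e)ᵀ * R e = 1)
    (hW : ∀ y x, (W y x)ᵀ * W y x = 1)
    (hWstep : ∀ (y : Fin d → ZMod M) (z : Fin d → Fin L) (μ : Fin d) (h : (z μ : ℕ) + 1 < L), (∀ ν, μ < ν → (z ν : ℕ) = 0) →
      W y (y, update z μ ⟨(z μ : ℕ) + 1, h⟩) = W y (y, z) * R ((y, z), μ))
    (hQ : ∀ (u : ((Fin d → ZMod M) × (Fin d → Fin L)) × o → ℝ) (y : Fin d → ZMod M),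
      (fun a => (Q *ᵥ u) (y, a)) = ∑ x, (if x.1 = y then ((L : ℝ) ^ d)⁻¹ else 0) • (W y x *ᵥ fun b => u (x, b)))
    (hHsym : Hfᵀ = Hf) {wf wf' : ℝ} (hwf : 0 < wf) (hwf' : 0 ≤ wf')
    (hHf : ∀ u : ((Fin d → ZMod M) × (Fin d → Fin L)) × o → ℝ,
      wf * ∑ e : ((Fin d → ZMod M) × (Fin d → Fin L)) × Fin d,
        ((R e *ᵥ fun b => u ((e.1.1 + ((((e.1.2 e.2 : ℕ) + 1) / L) • (Pi.single e.2 (1 : ZMod M))),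
            update e.1.2 e.2 ⟨((e.1.2 e.2 : ℕ) + 1) % L, Nat.mod_lt _ hL⟩), b)) - fun b => u (e.1, b)) ⬝ᵥ
          ((R e *ᵥ fun b => u ((e.1.1 + ((((e.1.2 e.2 : ℕ) + 1) / L) • (Pi.single e.2 (1 : ZMod M))),
            update e.1.2 e.2 ⟨((e.1.2 e.2 : ℕ) + 1) % L, Nat.mod_lt _ hL⟩), b)) - fun b => u (e.1, b)) ≤ u ⬝ᵥ (Hf *ᵥ u))
    (hHf' : ∀ u : ((Fin d → ZMod M) × (Fin d → Fin L)) × o → ℝ, u ⬝ᵥ (Hf *ᵥ u) ≤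
      wf' * ∑ e : ((Fin d → ZMod M) × (Fin d → Fin L)) × Fin d,
        ((R e *ᵥ fun b => u ((e.1.1 + ((((e.1.2 e.2 : ℕ) + 1) / L) • (Pi.single e.2 (1 : ZMod M))),
            update e.1.2 e.2 ⟨((e.1.2 e.2 : ℕ) + 1) % L, Nat.mod_lt _ hL⟩), b)) - fun b => u (e.1, b)) ⬝ᵥ
          ((R e *ᵥ fun b => u ((e.1.1 + ((((e.1.2 e.2 : ℕ) + 1) / L) • (Pi.single e.2 (1 : ZMod M))),
            update e.1.2 e.2 ⟨((e.1.2 e.2 : ℕ) + 1) % L, Nat.mod_lt _ hL⟩), b)) - fun b => u (e.1, b)))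
    {a h₀ δH : ℝ} (ha : 0 < a) (hh₀ : 0 ≤ h₀) (hδH : 0 < δH)
    (hHent : ∀ p q : ((Fin d → ZMod M) × (Fin d → Fin L)) × o, |Hf p q| ≤
      h₀ * Real.exp (-(δH * tdist (fun _ : Fin d => M) (fun i => (ZMod.finEquiv M).symm (p.1.1 i)) (fun i => (ZMod.finEquiv M).symm (q.1.1 i)))))
    {γK cK rF : ℝ}
    (hγK : γK = (max (4 * (4 * (d * ((L : ℝ) - 1)) ^ 2 * (L : ℝ) ^ d / wf))
        ((16 * d * (4 * (d * ((L : ℝ) - 1)) ^ 2 * (L : ℝ) ^ d / wf) * wf' * (L : ℝ) ^ d + 2 * (L : ℝ) ^ d) / a))⁻¹)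
    (hcK : cK = h₀ + a * Fintype.card o * (((L : ℝ) ^ d)⁻¹) ^ 2)
    (hrF : rF = rate (fun s => Fintype.card o * (L : ℝ) ^ d * latticeConst d s) γK cK δH)
    (b b' : (Fin d → ZMod M) × o) :
    |blockProp (Hf + Qᵀ * (a • (1 : Matrix ((Fin d → ZMod M) × o) ((Fin d → ZMod M) × o) ℝ)) * Q) Q b b'| ≤
      (Fintype.card o : ℝ) ^ 2 * (2 / γK) *
        Real.exp (-(rF * tdist (fun _ : Fin d => M) (fun i => (ZMod.finEquiv M).symm (b.1 i)) (fun i => (ZMod.finEquiv M).symm (b'.1 i)))) := by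
  have hγpos : 0 < γK := by rw [hγK]; exact gammaK_pos hL hwf hwf' ha
  have hcK0 : 0 ≤ cK := by rw [hcK]; positivity
  have hprof : ∀ s : ℝ, 0 < s → 0 ≤ Fintype.card o * (L : ℝ) ^ d * latticeConst d s := fun s hs => by
    have := latticeConst_nonneg d hs.le; positivity
  have hrF0 : 0 ≤ rF := by rw [hrF]; exact (rate_pos hprof hγpos hcK0 hδH).le
  have hG : ∀ p q : ((Fin d → ZMod M) × (Fin d → Fin L)) × o,
      |(Hf + Qᵀ * (a • (1 : Matrix ((Fin d → ZMod M) × o) ((Fin d → ZMod M) × o) ℝ)) * Q)⁻¹ p q| ≤ 2 / γK *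
        Real.exp (-(rF * tdist (fun _ : Fin d => M) (fun i => (ZMod.finEquiv M).symm (p.1.1 i)) (fun i => (ZMod.finEquiv M).symm (q.1.1 i)))) := by
    subst hγK hcK hrF
    exact abs_Kinv_apply_le hL hR hW hWstep hQ hHsym hwf hwf' hHf hHf' ha hh₀ hδH hHent
  have h := abs_blockProp_le_of_resolvent (Q := Q)
    (ρ := fun b b' : (Fin d → ZMod M) × o => tdist (fun _ : Fin d => M) (fun i => (ZMod.finEquiv M).symm (b.1 i)) (fun i => (ZMod.finEquiv M).symm (b'.1 i)))
    (D := fun p q : ((Fin d → ZMod M) × (Fin d → Fin L)) × o =>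
      tdist (fun _ : Fin d => M) (fun i => (ZMod.finEquiv M).symm (p.1.1 i)) (fun i => (ZMod.finEquiv M).symm (q.1.1 i)))
    (R := 0) (by positivity : (0 : ℝ) ≤ 2 / γK) hrF0 hG (sum_abs_Q_row_le hW hQ) (fun b x b' x' hb hb' => by
      simp only [fst_eq_of_Q_ne_zero hQ hb, fst_eq_of_Q_ne_zero hQ hb', add_zero, le_refl]) b b'
  simpa [mul_zero, Real.exp_zero] using h

/-- **`abs_Kinv_mul_transpose_le_lattice` — THE FINE-TO-UNIT DECAY OF `K⁻¹Qᵀ` ON THE BLOCK LATTICE** [our proof; PART 105 `abs_inv_mul_transpose_le_of_resolvent`, `R′ = 0`]: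
`|(K⁻¹Qᵀ)(p,b)| ≤ |o|·(2∕γ_K)·e^{−r_F·tdist(p.1.1,b.1)}`. -/
theorem abs_Kinv_mul_transpose_le_lattice (hL : 0 < L) {R : ((Fin d → ZMod M) × (Fin d → Fin L)) × Fin d → Matrix o o ℝ} (hR : ∀ e, (R e)ᵀ * R e = 1)
    (hW : ∀ y x, (W y x)ᵀ * W y x = 1)
    (hWstep : ∀ (y : Fin d → ZMod M) (z : Fin d → Fin L) (μ : Fin d) (h : (z μ : ℕ) + 1 < L), (∀ ν, μ < ν → (z ν : ℕ) = 0) →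
      W y (y, update z μ ⟨(z μ : ℕ) + 1, h⟩) = W y (y, z) * R ((y, z), μ))
    (hQ : ∀ (u : ((Fin d → ZMod M) × (Fin d → Fin L)) × o → ℝ) (y : Fin d → ZMod M),
      (fun a => (Q *ᵥ u) (y, a)) = ∑ x, (if x.1 = y then ((L : ℝ) ^ d)⁻¹ else 0) • (W y x *ᵥ fun b => u (x, b)))
    (hHsym : Hfᵀ = Hf) {wf wf' : ℝ} (hwf : 0 < wf) (hwf' : 0 ≤ wf')
    (hHf : ∀ u : ((Fin d → ZMod M) × (Fin d → Fin L)) × o → ℝ,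
      wf * ∑ e : ((Fin d → ZMod M) × (Fin d → Fin L)) × Fin d,
        ((R e *ᵥ fun b => u ((e.1.1 + ((((e.1.2 e.2 : ℕ) + 1) / L) • (Pi.single e.2 (1 : ZMod M))),
            update e.1.2 e.2 ⟨((e.1.2 e.2 : ℕ) + 1) % L, Nat.mod_lt _ hL⟩), b)) - fun b => u (e.1, b)) ⬝ᵥ
          ((R e *ᵥ fun b => u ((e.1.1 + ((((e.1.2 e.2 : ℕ) + 1) / L) • (Pi.single e.2 (1 : ZMod M))),
            update e.1.2 e.2 ⟨((e.1.2 e.2 : ℕ) + 1) % L, Nat.mod_lt _ hL⟩), b)) - fun b => u (e.1, b)) ≤ u ⬝ᵥ (Hf *ᵥ u))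
    (hHf' : ∀ u : ((Fin d → ZMod M) × (Fin d → Fin L)) × o → ℝ, u ⬝ᵥ (Hf *ᵥ u) ≤
      wf' * ∑ e : ((Fin d → ZMod M) × (Fin d → Fin L)) × Fin d,
        ((R e *ᵥ fun b => u ((e.1.1 + ((((e.1.2 e.2 : ℕ) + 1) / L) • (Pi.single e.2 (1 : ZMod M))),
            update e.1.2 e.2 ⟨((e.1.2 e.2 : ℕ) + 1) % L, Nat.mod_lt _ hL⟩), b)) - fun b => u (e.1, b)) ⬝ᵥ
          ((R e *ᵥ fun b => u ((e.1.1 + ((((e.1.2 e.2 : ℕ) + 1) / L) • (Pi.single e.2 (1 : ZMod M))),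
            update e.1.2 e.2 ⟨((e.1.2 e.2 : ℕ) + 1) % L, Nat.mod_lt _ hL⟩), b)) - fun b => u (e.1, b)))
    {a h₀ δH : ℝ} (ha : 0 < a) (hh₀ : 0 ≤ h₀) (hδH : 0 < δH)
    (hHent : ∀ p q : ((Fin d → ZMod M) × (Fin d → Fin L)) × o, |Hf p q| ≤
      h₀ * Real.exp (-(δH * tdist (fun _ : Fin d => M) (fun i => (ZMod.finEquiv M).symm (p.1.1 i)) (fun i => (ZMod.finEquiv M).symm (q.1.1 i)))))
    {γK cK rF : ℝ}
    (hγK : γK = (max (4 * (4 * (d * ((L : ℝ) - 1)) ^ 2 * (L : ℝ) ^ d / wf))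
        ((16 * d * (4 * (d * ((L : ℝ) - 1)) ^ 2 * (L : ℝ) ^ d / wf) * wf' * (L : ℝ) ^ d + 2 * (L : ℝ) ^ d) / a))⁻¹)
    (hcK : cK = h₀ + a * Fintype.card o * (((L : ℝ) ^ d)⁻¹) ^ 2)
    (hrF : rF = rate (fun s => Fintype.card o * (L : ℝ) ^ d * latticeConst d s) γK cK δH)
    (p : ((Fin d → ZMod M) × (Fin d → Fin L)) × o) (b : (Fin d → ZMod M) × o) :
    |((Hf + Qᵀ * (a • (1 : Matrix ((Fin d → ZMod M) × o) ((Fin d → ZMod M) × o) ℝ)) * Q)⁻¹ * Qᵀ) p b| ≤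
      (Fintype.card o : ℝ) * (2 / γK) *
        Real.exp (-(rF * tdist (fun _ : Fin d => M) (fun i => (ZMod.finEquiv M).symm (p.1.1 i)) (fun i => (ZMod.finEquiv M).symm (b.1 i)))) := by
  have hγpos : 0 < γK := by rw [hγK]; exact gammaK_pos hL hwf hwf' ha
  have hcK0 : 0 ≤ cK := by rw [hcK]; positivity
  have hprof : ∀ s : ℝ, 0 < s → 0 ≤ Fintype.card o * (L : ℝ) ^ d * latticeConst d s := fun s hs => by
    have := latticeConst_nonneg d hs.le; positivity
  have hrF0 : 0 ≤ rF := by rw [hrF]; exact (rate_pos hprof hγpos hcK0 hδH).le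
  have hG : ∀ p q : ((Fin d → ZMod M) × (Fin d → Fin L)) × o,
      |(Hf + Qᵀ * (a • (1 : Matrix ((Fin d → ZMod M) × o) ((Fin d → ZMod M) × o) ℝ)) * Q)⁻¹ p q| ≤ 2 / γK *
        Real.exp (-(rF * tdist (fun _ : Fin d => M) (fun i => (ZMod.finEquiv M).symm (p.1.1 i)) (fun i => (ZMod.finEquiv M).symm (q.1.1 i)))) := by
    subst hγK hcK hrF
    exact abs_Kinv_apply_le hL hR hW hWstep hQ hHsym hwf hwf' hHf hHf' ha hh₀ hδH hHent
  have h := abs_inv_mul_transpose_le_of_resolvent (Q := Q)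
    (σ := fun (p : ((Fin d → ZMod M) × (Fin d → Fin L)) × o) (b : (Fin d → ZMod M) × o) =>
      tdist (fun _ : Fin d => M) (fun i => (ZMod.finEquiv M).symm (p.1.1 i)) (fun i => (ZMod.finEquiv M).symm (b.1 i)))
    (D := fun p q : ((Fin d → ZMod M) × (Fin d → Fin L)) × o =>
      tdist (fun _ : Fin d => M) (fun i => (ZMod.finEquiv M).symm (p.1.1 i)) (fun i => (ZMod.finEquiv M).symm (q.1.1 i)))
    (R' := 0) (by positivity : (0 : ℝ) ≤ 2 / γK) hrF0 hG (sum_abs_Q_row_le hW hQ) (fun b' x x' hb' => by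
      simp only [fst_eq_of_Q_ne_zero hQ hb', add_zero, le_refl]) p b
  simpa [mul_zero, Real.exp_zero] using h

end Letters

end Summit.QuantumFields.BalabanUV.Beta.GAN24.EffectiveFormLocalisationLatticeSoft

end
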